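import Literature.NumberTheory.LFunctions.DirichletLOneHalfLogBoundEven
import Literature.NumberTheory.LFunctions.DirichletLOneRealZeroBoundEvenQuadratic
import Literature.NumberTheory.QuadraticFields.QuadraticDedekindZetaZeros
import Literature.NumberTheory.LFunctions.ClassGroupLFunctionExceptionalZeroQuadraticField
import Literature.NumberTheory.QuadraticFields.KroneckerCharacterEvenDiscriminant
import Literature.NumberTheory.QuadraticFields.QuadraticDedekindZetaKronecker
import Literature.NumberTheory.QuadraticFields.ScholzMirrorTorsionWitnessTools
import HarnessLib

/-!
# `Res_{s=1} ζ_K ≤ ½ log d_K + (2 + γ − log 4π)/2` and `h_K R_K ≤ ¼ √d_K (log d_K + 2 + γ − log 4π)` for real quadratic fields (proved)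

Topic `Literature/NumberTheory/LFunctions`, namespace `Literature.NumberTheory.LFunctions.Louboutin2001`.
Everything here is PROVED (no named facts, no definitions): the real-quadratic case `m = 2` of
Louboutin's Corollary 8, read off the kernel theorem `Louboutin2001.norm_LFunction_one_le`
(`DirichletLOneHalfLogBoundEven.lean`: `|L(1, χ)| ≤ ½ log f + µ_ℚ` for even primitive `χ`,
`µ_ℚ = (2 + γ − log 4π)/2 = 0.0230…`) through `ζ_K(s) = ζ(s) L(s, κ_K)` with the EVEN primitive
Kronecker character `κ_K` mod `d_K` of a real quadratic field and the class number formula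
`Res_{s=1} ζ_K = 2 h_K R_K/√d_K`.

## Source, as printed

S. Louboutin, *Explicit upper bounds for residues of Dedekind zeta functions and values of
`L`-functions at `s = 1`, and explicit lower bounds for relative class numbers of CM-fields*, Canad. J.
Math. 53 (2001) 1194–1222 [Louboutin2001CJM], **Corollary 8** (p. 1198): «Let `L` be a real abelian
number field of degree `m > 1`, discriminant `d_L` and conductor `f_L` (notice that `d_L ≤ f_L^{m−1}`).
1. We have the following improvement on (1) and (6):
**(17)** `Res_{s=1}(ζ_L) ≤ ((1/(2(m−1))) log d_L + µ_ℚ)^{m−1}`.»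
(proof p. 1198: «using the fact that the geometric mean is less than or equal to the arithmetic mean
and using the conductor-discriminant formula» from Theorem 7 (15)); §2.1 p. 1195:
`µ_ℚ = (2 + γ − log(4π))/2 = 0.023095…`.  The case `m = 2` (real quadratic `L = K`, `ζ_K = ζ · L(s, κ_K)`,
`f_{κ_K} = d_K`) reads **`Res_{s=1}(ζ_K) ≤ ½ log d_K + µ_ℚ`** — also (7) p. 795 of S. Louboutin,
*Upper bounds on `|L(1, χ)|` and applications*, Canad. J. Math. 50 (1998) 794–815: «for any real
quadratic field `k` of discriminant `d_k` we get `Res_{s=1}(ζ_k) ≤ ½ log d_k + µ_ℚ`».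
[cite: Louboutin2001CJM, Cor 8 (17) p. 1198]

## What is proved

* `dedekindZeta_residue_le_of_discr_pos` — **(17), `m = 2`**: for a number field `K` with `[K : ℚ] = 2`
  and `d_K > 0`: `Res_{s=1} ζ_K ≤ ½ log d_K + (2 + γ − log 4π)/2` (Mathlib's
  `NumberField.dedekindZeta_residue`);
* `classNumber_mul_regulator_le_of_discr_pos` — the class-number form
  **`h_K R_K ≤ √d_K (½ log d_K + (2 + γ − log 4π)/2)/2`** via `Res_{s=1} ζ_K = 2 h_K R_K/√d_K`
  (tree `dedekindZeta_residue_eq_of_discr_pos`), and the decimal `h_K R_K ≤ √d_K (log d_K + 0.0462)/4`.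
* (appended 2026-08-29) the EXCEPTIONAL-ZERO forms — Louboutin, Acta Arith. 121 (2006) Theorem 1 (ii) (3),
  EVEN quadratic case, AS PRINTED (`Louboutin2001.norm_LFunction_one_le_of_zero`:
  `|L(1, χ)| ≤ (1 − β) log² f/8`, `DirichletLOneRealZeroBoundEvenQuadratic.lean`) read on the real quadratic
  field: if the continued Dedekind zeta function `dedekindZetaCont K` vanishes at a real `β ∈ (0, 1)`, then
  `Res_{s=1} ζ_K ≤ (1 − β) log² d_K/8` (`dedekindZeta_residue_le_of_dedekindZetaCont_eq_zero`) and
  **`h_K R_K ≤ (1 − β) √d_K log² d_K/16`** (`classNumber_mul_regulator_le_of_dedekindZetaCont_eq_zero`) — the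
  «small `h_K R_K`» of the illusory world for real quadratic fields, with the printed constant; companion
  of `classNumber_le_of_dedekindZetaCont_eq_zero_sharp` (imaginary quadratic,
  `ImaginaryQuadraticClassNumberHalfLogBound.lean`).

Ingredients (tree): the even primitive Kronecker character of a real quadratic field — odd `d_K`:
`jacobiChar |d_K|` (`Quadratic.dedekindZeta_eq_riemannZeta_mul_LSeries`, `isPrimitive_jacobiChar`,
`jacobiChar_natAbs_discr_ne_one`; parity `(−1/d) = χ₄(d) = 1` for `d ≡ 1 (mod 4)`, Mathlib
`jacobiSym.at_neg_one`), even `d_K`: `Quadratic.exists_kroneckerChar_of_four_dvd` (parity included);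
`Quadratic.LFunction_one_eq_dedekindZeta_residue_of_eq` (`L(1, κ) = Res_{s=1} ζ_K`).
Compare: the tree's `RealQuadraticRegulatorLowerBound.lean` (LOWER bounds for the residue).

LABEL (cell rule): statement layer → kernel theorem; unconditional; no compute; no Parity credit (H5).
-/

noncomputable section

open Complex Real

namespace Literature.NumberTheory.LFunctions

namespace Louboutin2001

open DirichletCharacter Literature.NumberTheory.QuadraticFields
  Literature.NumberTheory.QuadraticFields.Quadratic

variable {K : Type*} [Field K] [NumberField K]

/-- The Kronecker character of a REAL quadratic field is an even primitive character `κ ≠ 1` mod `d_K`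
with `ζ_K(s) = ζ(s) L(s, κ)` (`Re s > 1`) — odd `d_K ≡ 1 (mod 4)`: the Jacobi character, `(−1/d_K) =
χ₄(d_K) = 1`; even `d_K`: the tree's Kronecker character mod `4|m|`. [folklore] -/
private theorem exists_even_kroneckerChar (h2 : Module.finrank ℚ K = 2) (hd : 0 < NumberField.discr K) :
    ∃ (M : ℕ) (_ : NeZero M) (κ : DirichletCharacter ℂ M), M = (NumberField.discr K).natAbs ∧ κ ≠ 1 ∧
      κ.IsPrimitive ∧ κ.Even ∧
      ∀ s : ℂ, 1 < s.re → NumberField.dedekindZeta K s = riemannZeta s * LSeries (fun n ↦ κ n) s := by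
  rcases isFundamentalDiscriminant_discr (K := K) h2 with ⟨h1, hsqf, -⟩ | ⟨h4, -, -⟩
  · -- odd discriminant `d ≡ 1 (mod 4)`
    have hodd : Odd (NumberField.discr K) := by rw [Int.odd_iff]; omega
    haveI := neZero_natAbs_discr (K := K)
    have hoddN : Odd (NumberField.discr K).natAbs := Int.natAbs_odd.mpr hodd
    have hsqN : Squarefree (NumberField.discr K).natAbs := Int.squarefree_natAbs.mpr hsqf
    have hmod : (NumberField.discr K).natAbs % 4 = 1 := by
      have : ((NumberField.discr K).natAbs : ℤ) = NumberField.discr K :=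
        Int.natAbs_of_nonneg hd.le
      omega
    have heven : (jacobiChar (NumberField.discr K).natAbs).Even := by
      show jacobiChar (NumberField.discr K).natAbs (-1) = 1
      have h := jacobiChar_intCast (q := (NumberField.discr K).natAbs) (-1)
      rw [Int.cast_neg, Int.cast_one] at h
      rw [h, jacobiSym.at_neg_one hoddN, ZMod.χ₄_nat_one_mod_four hmod, Int.cast_one]
    exact ⟨(NumberField.discr K).natAbs, inferInstance, jacobiChar (NumberField.discr K).natAbs, rfl,
      jacobiChar_natAbs_discr_ne_one h2 hodd, isPrimitive_jacobiChar hoddN hsqN, heven,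
      fun s hs ↦ dedekindZeta_eq_riemannZeta_mul_LSeries h2 hodd hs⟩
  · -- even discriminant
    haveI := neZero_natAbs_discr (K := K)
    obtain ⟨κ, hprim, -, hne, -, hev, -, hfac⟩ := exists_kroneckerChar_of_four_dvd h2 h4
    exact ⟨(NumberField.discr K).natAbs, inferInstance, κ, rfl, hne, hprim, hev hd, hfac⟩

/-- **Louboutin 2001, Corollary 8 (17) for `m = 2`** (= Canad. J. Math. 50 (1998) (7)): for a real
quadratic field `K` (`[K : ℚ] = 2`, `d_K > 0`),
**`Res_{s=1} ζ_K ≤ ½ log d_K + µ_ℚ`**, `µ_ℚ = (2 + γ − log 4π)/2` — from Theorem 7 (15) applied to the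
even primitive Kronecker character `κ_K` mod `d_K` (`ζ_K = ζ · L(s, κ_K)`, `Res_{s=1} ζ_K = L(1, κ_K)`).
[cite: Louboutin2001CJM, Cor 8 (17) p. 1198] -/
theorem dedekindZeta_residue_le_of_discr_pos (h2 : Module.finrank ℚ K = 2)
    (hd : 0 < NumberField.discr K) :
    NumberField.dedekindZeta_residue K ≤
      Real.log (NumberField.discr K) / 2 + (2 + Real.eulerMascheroniConstant - Real.log (4 * π)) / 2 := by
  obtain ⟨M, _, κ, hM, hκ, hprim, heven, hfac⟩ := exists_even_kroneckerChar h2 hd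
  have hL : κ.LFunction 1 = (NumberField.dedekindZeta_residue K : ℂ) :=
    LFunction_one_eq_dedekindZeta_residue_of_eq (K := K) hκ (fun s hs ↦ hfac s (by simpa using hs))
  have hB := norm_LFunction_one_le κ hprim hκ heven
  rw [hL, Complex.norm_real, Real.norm_eq_abs] at hB
  have hMd : (M : ℝ) = (NumberField.discr K : ℝ) := by
    obtain ⟨n, hn⟩ := Int.eq_ofNat_of_zero_le hd.le
    rw [hM, hn]; simp
  rw [hMd] at hB
  exact (le_abs_self _).trans hB

/-- **Class-number form of (17), `m = 2`**: for a real quadratic field `K`,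
**`h_K · R_K ≤ √d_K (½ log d_K + (2 + γ − log 4π)/2)/2`** (`Res_{s=1} ζ_K = 2 h_K R_K/√d_K`,
`w_K = 2`). [cite: Louboutin2001CJM, Cor 8 (17) p. 1198] -/
theorem classNumber_mul_regulator_le_of_discr_pos (h2 : Module.finrank ℚ K = 2)
    (hd : 0 < NumberField.discr K) :
    (NumberField.classNumber K : ℝ) * NumberField.Units.regulator K ≤
      Real.sqrt (NumberField.discr K) *
        (Real.log (NumberField.discr K) / 2 + (2 + Real.eulerMascheroniConstant - Real.log (4 * π)) / 2) / 2 := by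
  have h := dedekindZeta_residue_le_of_discr_pos h2 hd
  rw [dedekindZeta_residue_eq_of_discr_pos K h2 hd] at h
  have hsq : 0 < Real.sqrt (NumberField.discr K) := Real.sqrt_pos.mpr (by exact_mod_cast hd)
  rw [div_le_iff₀ hsq] at h
  nlinarith [h]

/-- Decimal form: **`h_K R_K ≤ √d_K (log d_K + 0.0462)/4`** for every real quadratic field `K`
(`2µ_ℚ = 0.04619…`). [cite: Louboutin2001CJM, Cor 8 (17) p. 1198] -/
theorem classNumber_mul_regulator_le_of_discr_pos_d4 (h2 : Module.finrank ℚ K = 2)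
    (hd : 0 < NumberField.discr K) :
    (NumberField.classNumber K : ℝ) * NumberField.Units.regulator K ≤
      Real.sqrt (NumberField.discr K) * (Real.log (NumberField.discr K) + 0.0462) / 4 := by
  have h := classNumber_mul_regulator_le_of_discr_pos h2 hd
  have hmu := mu_lt
  rw [mu_eq] at hmu
  have hsq : 0 ≤ Real.sqrt (NumberField.discr K) := Real.sqrt_nonneg _
  have : Real.sqrt (NumberField.discr K) *
      (Real.log (NumberField.discr K) / 2 + (2 + Real.eulerMascheroniConstant - Real.log (4 * π)) / 2) / 2 ≤
      Real.sqrt (NumberField.discr K) * (Real.log (NumberField.discr K) + 0.0462) / 4 := by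
    rw [mul_div_assoc]
    have hle : (Real.log (NumberField.discr K) / 2 +
        (2 + Real.eulerMascheroniConstant - Real.log (4 * π)) / 2) / 2 ≤
        (Real.log (NumberField.discr K) + 0.0462) / 4 := by
      norm_num at hmu ⊢; linarith
    calc _ ≤ Real.sqrt (NumberField.discr K) * ((Real.log (NumberField.discr K) + 0.0462) / 4) :=
          mul_le_mul_of_nonneg_left hle hsq
      _ = _ := by ring
  exact h.trans this

/-! ### Exceptional-zero forms (Louboutin 2006 Theorem 1 (ii) (3), even quadratic case, AS PRINTED) -/

/-- The Kronecker character of a real quadratic field with quadraticity recorded (odd `d_K`: the Jacobi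
character, values in `{0, ±1}`; even `d_K`: the tree's Kronecker character mod `4|m|`). [folklore] -/
private theorem exists_even_quadratic_kroneckerChar (h2 : Module.finrank ℚ K = 2)
    (hd : 0 < NumberField.discr K) :
    ∃ (M : ℕ) (_ : NeZero M) (κ : DirichletCharacter ℂ M), M = (NumberField.discr K).natAbs ∧ κ ≠ 1 ∧
      κ.IsPrimitive ∧ κ.Even ∧ κ.IsQuadratic ∧
      ∀ s : ℂ, 1 < s.re → NumberField.dedekindZeta K s = riemannZeta s * LSeries (fun n ↦ κ n) s := by
  rcases isFundamentalDiscriminant_discr (K := K) h2 with ⟨h1, hsqf, -⟩ | ⟨h4, -, -⟩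
  · have hodd : Odd (NumberField.discr K) := by rw [Int.odd_iff]; omega
    haveI := neZero_natAbs_discr (K := K)
    have hoddN : Odd (NumberField.discr K).natAbs := Int.natAbs_odd.mpr hodd
    have hsqN : Squarefree (NumberField.discr K).natAbs := Int.squarefree_natAbs.mpr hsqf
    have hmod : (NumberField.discr K).natAbs % 4 = 1 := by
      have : ((NumberField.discr K).natAbs : ℤ) = NumberField.discr K :=
        Int.natAbs_of_nonneg hd.le
      omega
    have heven : (jacobiChar (NumberField.discr K).natAbs).Even := by
      show jacobiChar (NumberField.discr K).natAbs (-1) = 1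
      have h := jacobiChar_intCast (q := (NumberField.discr K).natAbs) (-1)
      rw [Int.cast_neg, Int.cast_one] at h
      rw [h, jacobiSym.at_neg_one hoddN, ZMod.χ₄_nat_one_mod_four hmod, Int.cast_one]
    exact ⟨(NumberField.discr K).natAbs, inferInstance, jacobiChar (NumberField.discr K).natAbs, rfl,
      jacobiChar_natAbs_discr_ne_one h2 hodd, isPrimitive_jacobiChar hoddN hsqN, heven,
      fun a ↦ jacobiChar_trichotomy a,
      fun s hs ↦ dedekindZeta_eq_riemannZeta_mul_LSeries h2 hodd hs⟩
  · haveI := neZero_natAbs_discr (K := K)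
    obtain ⟨κ, hprim, hquad, hne, -, hev, -, hfac⟩ := exists_kroneckerChar_of_four_dvd h2 h4
    exact ⟨(NumberField.discr K).natAbs, inferInstance, κ, rfl, hne, hprim, hev hd, hquad, hfac⟩

open scoped ComplexOrder in
/-- **Exceptional zero ⇒ small residue, real quadratic fields, with Louboutin's printed constant:** for
`K` with `[K : ℚ] = 2`, `d_K > 0`, if `ζ_K(β) = 0` (the continued Dedekind zeta function
`dedekindZetaCont K`) for a real `0 < β < 1`, then **`Res_{s=1} ζ_K ≤ (1 − β) log² d_K/8`** — Louboutin
2006 Theorem 1 (ii) (3), even quadratic case, AS PRINTED (`norm_LFunction_one_le_of_zero`), read through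
`ζ_K = ζ · L(·, κ_K)` off `s = 1`, `ζ(β) < 0` on `(0, 1)` (so `L(β, κ_K) = 0`), and
`Res_{s=1} ζ_K = L(1, κ_K)`. [cite: Louboutin2006RelativeClassNumbers, Thm 1 (3) p. 200]
[cite: NeukirchANT1999, Ch. VII §5 (5.11)] -/
theorem dedekindZeta_residue_le_of_dedekindZetaCont_eq_zero (h2 : Module.finrank ℚ K = 2)
    (hd : 0 < NumberField.discr K) {β : ℝ} (hβ0 : 0 < β) (hβ1 : β < 1)
    (hz : dedekindZetaCont K β = 0) :
    NumberField.dedekindZeta_residue K ≤ (1 - β) * Real.log (NumberField.discr K) ^ 2 / 8 := by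
  obtain ⟨M, _, κ, hM, hκ, hprim, heven, hquad, hfac⟩ := exists_even_quadratic_kroneckerChar h2 hd
  -- `ζ_K(β) = ζ(β) L(β, κ)` and `ζ(β) ≠ 0`
  have hβne : (β : ℂ) ≠ 1 := by
    intro h
    have := congrArg Complex.re h
    simp at this
    linarith
  have hfacβ := dedekindZetaCont_eq_riemannZeta_mul_LFunction (K := K) hκ hfac hβne
  rw [hz] at hfacβ
  have hζ : riemannZeta β ≠ 0 := (riemannZeta_neg_of_pos_of_lt_one hβ0 hβ1).ne
  have hLβ : κ.LFunction β = 0 := by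
    rcases mul_eq_zero.mp hfacβ.symm with h | h
    · exact absurd h hζ
    · exact h
  have hB := norm_LFunction_one_le_of_zero hprim hκ heven hquad hβ0 hβ1 hLβ
  have hL : κ.LFunction 1 = (NumberField.dedekindZeta_residue K : ℂ) :=
    LFunction_one_eq_dedekindZeta_residue_of_eq (K := K) hκ (fun s hs ↦ hfac s (by simpa using hs))
  rw [hL, Complex.norm_real, Real.norm_eq_abs] at hB
  have hMd : (M : ℝ) = (NumberField.discr K : ℝ) := by
    obtain ⟨n, hn⟩ := Int.eq_ofNat_of_zero_le hd.le
    rw [hM, hn]; simp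
  rw [hMd] at hB
  exact (le_abs_self _).trans hB

/-- **Exceptional zero ⇒ small `h_K R_K`, real quadratic fields, explicitly:** for `K` with `[K : ℚ] = 2`,
`d_K > 0`, `ζ_K(β) = 0` for a real `0 < β < 1` gives **`h_K · R_K ≤ (1 − β) √d_K log² d_K/16`**
(`Res_{s=1} ζ_K = 2 h_K R_K/√d_K`, `w_K = 2`). Contrapositive: `h_K R_K > (1 − β) √d_K log² d_K/16` EXCLUDES
a zero of `ζ_K` at `β`. Companion of the imaginary-quadratic `classNumber_le_of_dedekindZetaCont_eq_zero_sharp`.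
[cite: Louboutin2006RelativeClassNumbers, Thm 1 (3) p. 200] [cite: NeukirchANT1999, Ch. VII §5 (5.11)] -/
theorem classNumber_mul_regulator_le_of_dedekindZetaCont_eq_zero (h2 : Module.finrank ℚ K = 2)
    (hd : 0 < NumberField.discr K) {β : ℝ} (hβ0 : 0 < β) (hβ1 : β < 1)
    (hz : dedekindZetaCont K β = 0) :
    (NumberField.classNumber K : ℝ) * NumberField.Units.regulator K ≤
      (1 - β) * Real.sqrt (NumberField.discr K) * Real.log (NumberField.discr K) ^ 2 / 16 := by
  have h := dedekindZeta_residue_le_of_dedekindZetaCont_eq_zero h2 hd hβ0 hβ1 hz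
  rw [dedekindZeta_residue_eq_of_discr_pos K h2 hd] at h
  have hsq : 0 < Real.sqrt (NumberField.discr K) := Real.sqrt_pos.mpr (by exact_mod_cast hd)
  rw [div_le_iff₀ hsq] at h
  nlinarith [h]

end Louboutin2001

end Literature.NumberTheory.LFunctions
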